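import Literature.MathematicalPhysics.QuantumFieldTheory.Balaban1983to89.B4Ineq112WalkRoute
import Literature.MathematicalPhysics.QuantumFieldTheory.Balaban1983to89.B4Ineq110WalkRouteDeriv

/-!
# `Balaban1983to89.B4Ineq112WalkRouteDeriv` — [Balaban1983RegularityDecay] THEOREM (1.11)–(1.12), DERIVATIVE member: the
# decay of the covariant bond differences of `δG_k(Ω,Ω₀,A) = G_k(Ω,A) − G_k(Ω₀,A)` with the printed exponent
# «(2M)⁻¹(dist(x, supp f) + dist(x, Ω^c) + dist(supp f, Ω^c))», BY THE PRINTED CANCELLATION OF THE TWO WALK EXPANSIONS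
# (p. 579), END TO END on the concrete operators, for EVERY pair of regions and EVERY configuration, modulo the per-cube
# sup inputs

statement-level skeleton of published theorems with citation tags; proofs where landed; nothing here is a claim about the Yang–Mills mass gap

CITATION HEADER.  T. Bałaban, *Regularity and decay of lattice Green's functions*, Commun. Math. Phys. **89** (1983)
571–597, doi:10.1007/bf01214744 [Balaban1983RegularityDecay] (cell paper B4; held text
`paper:balaban1983-cmp89-regularity-decay`, journal page = PDF page + 570; pp. 572–573, 576–579, 581).  Unit
`lit-balaban-r01` gen 6 (B4 fold owner), HOME `run/shared/lean/pub/lit-balaban/`, SKELETON rows **B4.Thm@573** ((1.11)–(1.12),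
derivative member), **B4.Cor2.3** (δG clause), **B4.Eq2.12**, **B4.Eq2.18**.  Theorems only; imports `B4Ineq112WalkRoute`
(value member: `interior_letters_agree`, the cancellation set-up) and `B4Ineq110WalkRouteDeriv` (the bond operator
`P_b = E_{xy}[W(x,y)] − E_{xx}[1]`: `unitOp_mul_mulH`, `norm_unitOp_le`, `fld_bondOp_mulVec`).  Norm: Mathlib's scope
`Matrix.Norms.Operator` (`ℓ^∞ → ℓ^∞` operator norm over sites AND colours).

WHAT IS PRINTED (verbatim).  p. 573: *«Similarly |(D^η_{A,μ}G_k(Ω,A)f)(x)|, |(G_k(Ω,A)f)(x)| ≤ c₀exp(−δ₀dist(x, supp f))‖f‖_∞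
(1.10) for x ∈ Ω, dist(x,Ω^c) ≥ R₀.  If Ω ⊂ Ω₀, then for δG_k(Ω,Ω₀,A) defined by the equality
δG_k(Ω,Ω₀,A) = G_k(Ω,A) − G_k(Ω₀,A), (1.11) we have the inequalities (1.5) and (1.6)»* ⟦= (1.9) and (1.10)⟧ *«(with the
same restrictions on x, x′) with the additional factor (1.12) … on the right hand sides.»*; p. 579: *«To prove the
corresponding inequalities for δG_k(Ω,Ω₀,A) = G_k(Ω,A) − G_k(Ω₀,A) with Ω ⊂ Ω₀, we take the representations (2.13) for
both propagators. The terms with ω such that □_{ω_i} are interior cubes of Ω are the same in both representations, so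
they cancel in the difference, and for δG_k we get a representation similar to (2.13) with the additional restriction
that at least one □_{ω_i} intersects the boundary ∂Ω. We estimate the terms of the representation as above and we get
the first inequality in (2.22) with 2^{d+1} instead of 2^d and with the restriction n ≥ … ≥ (2M)⁻¹(dist({x,x′}, supp f)
+ dist({x,x′}, Ω^c) + dist(supp f, Ω^c)) − 3.»*  «As above» includes the derivative member of (1.10): the covariant
bond difference (1.3) `U(A_b)φ(b₊) − φ(b₋)` applied to the walk expansion (the file `B4Ineq110WalkRouteDeriv`).

WHAT THIS MODULE PROVES (all in full).
* **`ineq112_deriv`** — setting of `B4Ineq112WalkRoute.ineq112_value` (sites `X` of `Ω₀`, `H = covOp c m² a q W T`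
  (1.6) with inverse `G′ = G_k(Ω₀,A)`; the sub-region `Ω` through the NEUMANN CUT `c^Ω(z,z′) = 1[z ∈ Ω ↔ z′ ∈ Ω]c(z,z′)`
  with inverse `G`; block-compatible cube sets `S_j`; cube propagators `G_j`, `G_j^Ω`) and the bond `b = ⟨x,y⟩`
  (`|x − y|_∞ ≤ M/8`) of `B4Ineq110WalkRouteDeriv.ineq110_deriv` with `w ≥` the row `ℓ¹`-norms of `W(x,y)`; per-cube
  inputs `γ ≥ ‖G_j‖, ‖G_j^Ω‖`, `γ' ≥ ‖P_bG_j‖, ‖P_bG_j^Ω‖`, factor bounds `≤ β` for both families with (2.21)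
  `3^dβ ≤ e⁻¹`.  Conclusion: for every site set `F` and reals `D ≤ dist_∞(x,F)`, `D₀ ≤ dist_∞(x,Ω^c)`,
  `D₁ ≤ dist_∞(F,Ω^c)`:  `‖P_b·(G − G′)·1_F‖ ≤ 2^{d+3}e^{35/8}(γ' + (1 + w)γ)·exp(−(D + D₀ + D₁)/(2M))`.
  Far (`(D + D₀ + D₁)/(2M) ≥ 35/8`): `B4RandomWalkDelta112.lattice_walk_delta_bound` with `P = P_b` over the label type
  `↥s` — the interior labels cancel (`B4Ineq112WalkRoute.interior_letters_agree`), at most `2^{d+1}` starting cubes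
  (those seeing `x` or `y`), `‖P_b·h_jG_jh_j‖ ≤ γ' + wγ` by `P_b·h_j = h_j(x)P_b + (h_j(y) − h_j(x))E_{xy}[W]`, every
  surviving walk passes a cube meeting `Ω^c` (label separation `⌊(D + D₀ + D₁)/(2M) − 27/8⌋` through it), then
  `B4LpChain221.tail_222`; near: `‖P_b‖(‖G‖ + ‖G′‖) ≤ (1 + w)2^{d+2}γ` (`B4Ineq110WalkRoute.norm_le_of_neumann`).
* **`ineq112_deriv_apply`** — the printed shape: for `f` supported in `F`, `sup|f| ≤ φ`, every colour `k`,
  `|(W(x,y)(δG_kf)(y) − (δG_kf)(x))_k| ≤ 2^{d+3}e^{35/8}(γ' + (1 + w)γ)·exp(−(D + D₀ + D₁)/(2M))·φ`.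

HONEST SCOPE.  As in `B4Ineq112WalkRoute` / `B4Ineq110WalkRouteDeriv`: derivative member of the δG clause only (the
Hölder member (1.9) of the δG clause is not treated); the sup inputs `γ, γ', β` are ASSUMED for every cube of BOTH
families (no `R₀`; they are Lemmas 2.1/2.2 at `Ã_j`, reserve item R9 at `A ≠ 0`); `Ω ⊂ Ω₀` is modelled by the Neumann
cut of the bond weights inside the common site set; the constant carries the colour row-norm `w` of the link variable
because the `ℓ^∞` norm here runs over sites and colours; the factor `η⁻¹` of `D^η` is carried by the weights (dictionary
of `B4GaugeCovariance`).  No `def`, no `Prop` fact, no `sorry`; axioms standard.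
-/

namespace Literature.MathematicalPhysics.QuantumFieldTheory.Balaban1983to89.B4Ineq112WalkRouteDeriv

open Literature.MathematicalPhysics.QuantumFieldTheory.Balaban1983to89.B4GaugeCovariance
open Literature.MathematicalPhysics.QuantumFieldTheory.Balaban1983to89.B4Commutators25to211
open Literature.MathematicalPhysics.QuantumFieldTheory.Balaban1983to89.B4PartitionUnity22
open Literature.MathematicalPhysics.QuantumFieldTheory.Balaban1983to89.B4RandomWalk213
open Literature.MathematicalPhysics.QuantumFieldTheory.Balaban1983to89.B4RandomWalkDelta112
open Literature.MathematicalPhysics.QuantumFieldTheory.Balaban1983to89.B4LpChain221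
open Literature.MathematicalPhysics.QuantumFieldTheory.Balaban1983to89.B4Eq213Locality
open Literature.MathematicalPhysics.QuantumFieldTheory.Balaban1983to89.B4Eq26Locality
open Literature.MathematicalPhysics.QuantumFieldTheory.Balaban1983to89.B4Eq213ConcreteWalk
open Literature.MathematicalPhysics.QuantumFieldTheory.Balaban1983to89.B4Eq212SmallR
open Literature.MathematicalPhysics.QuantumFieldTheory.Balaban1983to89.B4Ineq110WalkRoute
open Literature.MathematicalPhysics.QuantumFieldTheory.Balaban1983to89.B4Ineq112WalkRoute
open Literature.MathematicalPhysics.QuantumFieldTheory.Balaban1983to89.B4Ineq110WalkRouteDeriv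
open scoped Matrix NNReal

open scoped Matrix.Norms.Operator

/-! ## §1. Norm plumbing -/

section Norm

variable {m n : Type*} [Fintype m] [Fintype n]

/-- a row sum is at most the `ℓ^∞`-operator norm. [folklore] -/
private theorem row_sum_le_norm (A : Matrix m n ℝ) (i : m) : ∑ j, |A i j| ≤ ‖A‖ := by
  rw [Matrix.linfty_opNorm_def]
  have h : (∑ j, ‖A i j‖₊ : ℝ≥0) ≤ Finset.univ.sup fun i => ∑ j, ‖A i j‖₊ :=
    Finset.le_sup (f := fun i => ∑ j, ‖A i j‖₊) (Finset.mem_univ i)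
  have h' := NNReal.coe_le_coe.mpr h
  simp only [NNReal.coe_sum, coe_nnnorm, Real.norm_eq_abs] at h'
  exact h'

/-- `|(Af)_i| ≤ ‖A‖·sup|f|`. [folklore] -/
private theorem abs_mulVec_le (A : Matrix m n ℝ) (f : n → ℝ) {φ : ℝ} (hφ : 0 ≤ φ) (hf : ∀ j, |f j| ≤ φ)
    (i : m) : |(A *ᵥ f) i| ≤ ‖A‖ * φ := by
  rw [Matrix.mulVec, dotProduct]
  calc |∑ j, A i j * f j| ≤ ∑ j, |A i j * f j| := Finset.abs_sum_le_sum_abs _ _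
    _ ≤ ∑ j, |A i j| * φ := Finset.sum_le_sum fun j _ => by
        rw [abs_mul]; exact mul_le_mul_of_nonneg_left (hf j) (abs_nonneg _)
    _ = (∑ j, |A i j|) * φ := by rw [Finset.sum_mul]
    _ ≤ ‖A‖ * φ := mul_le_mul_of_nonneg_right (row_sum_le_norm A i) hφ

end Norm

/-! ## §2. THEOREM (1.11)–(1.12), derivative member, by the cancellation of the two walk expansions -/

section Route

variable {X Y κ : Type*} [Fintype X] [Fintype Y] [Fintype κ] [DecidableEq X] [DecidableEq κ] {d : ℕ}

/-- the labels that can see the site `x` number at most `2^d`. [cite: Balaban1983RegularityDecay, §2 p.575] -/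
private theorem card_labelBox_le (M : ℝ) (x : Fin d → ℝ) :
    (Fintype.piFinset fun μ => ({⌊x μ / M⌋, ⌊x μ / M⌋ + 1} : Finset ℤ)).card ≤ 2 ^ d := by
  rw [Fintype.card_piFinset]
  calc ∏ μ, ({⌊x μ / M⌋, ⌊x μ / M⌋ + 1} : Finset ℤ).card ≤ 2 ^ (Finset.univ : Finset (Fin d)).card :=
        Finset.prod_le_pow_card _ _ 2 fun μ _ => Finset.card_le_two
    _ = 2 ^ d := by rw [Finset.card_univ, Fintype.card_fin]

/-- `e⁻¹ ≤ 1/2`. [folklore] -/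
private theorem exp_neg_one_le_half : Real.exp (-1) ≤ 1 / 2 := by
  have h := Real.add_one_le_exp (1 : ℝ)
  rw [Real.exp_neg, inv_eq_one_div]
  exact one_div_le_one_div_of_le (by norm_num) (by linarith)

-- both walk expansions and the bond operator are unfolded in one statement: twice the budget of the value member
set_option maxHeartbeats 400000 in
/-- **THEOREM (1.11)–(1.12), DERIVATIVE MEMBER, BY THE PRINTED CANCELLATION OF THE TWO WALK EXPANSIONS (p. 579), END TO
END on [B4]'s concrete operators, for EVERY pair of regions `Ω ⊂ Ω₀` and EVERY configuration `A`, modulo the per-cube sup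
inputs.**  Setting: the sites `X` of `Ω₀` with the operator `H = covOp c m² a q W T` (1.6) and its inverse
`G′ = G_k(Ω₀,A)`; the sub-region `Ω` (a site predicate) entering through the NEUMANN CUT of the bond weights at `∂Ω`,
`c^Ω(z,z′) = 1[z ∈ Ω ↔ z′ ∈ Ω]c(z,z′)`, with inverse `G = G_k(Ω,A) ⊕ (exterior part)`; the constructed partition of unity
`h_j`; block-compatible cube sets `S_j` (`(7/8)M`-box `⊆ S_j ⊆ M`-box, no averaging block crosses `∂S_j`) with cube
propagators `G_j` (cut of `c`) and `G_j^Ω` (cut of `c^Ω`); the bond `b = ⟨x, y⟩` (`|x − y|_∞ ≤ M/8`) with its covariant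
difference operator `P_b = E_{xy}[W(x,y)] − E_{xx}[1]` and `w ≥` the row sums of `|W(x,y)|`; the per-cube inputs
`γ ≥ ‖G_j‖, ‖G_j^Ω‖`, `γ' ≥ ‖P_bG_j‖, ‖P_bG_j^Ω‖` (Lemma 2.2 (2.17) at `p = q = ∞`, values and covariant derivatives),
factor bounds `≤ β` with (2.21) `3^dβ ≤ e⁻¹`.  Then for every site set `F` and reals `D ≤ dist_∞(x,F)`,
`D₀ ≤ dist_∞(x,Ω^c)`, `D₁ ≤ dist_∞(F,Ω^c)`:
`‖P_b·(G_k(Ω,A) − G_k(Ω₀,A))·1_F‖ ≤ 2^{d+3}e^{35/8}(γ' + (1 + w)γ)·exp(−(D + D₀ + D₁)/(2M))` — the printed exponent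
«(2M)⁻¹(dist(x, supp f) + dist(x, Ω^c) + dist(supp f, Ω^c))» of p. 579 on the derivative member.  Mechanism: interior
cubes (`S_j ⊆ Ω`) give IDENTICAL letters in both expansions (`B4Ineq112WalkRoute.interior_letters_agree`), so only walks
through a cube meeting `Ω^c` survive (`B4RandomWalkDelta112.lattice_walk_delta_bound` with `P = P_b`: at most `2^{d+1}`
starting cubes — those seeing `x` or `y` —, `‖P_b·h_jG_jh_j‖ ≤ γ' + wγ`, factor `2` «2^{d+1} instead of 2^d»); near the
diagonal the sizes `‖P_b‖ ≤ 1 + w`, `‖G‖, ‖G′‖ ≤ 2^{d+1}γ` suffice.  HONEST SCOPE as in `B4Ineq112WalkRoute.ineq112_value`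
(sup inputs assumed for every cube of both families; the Hölder member is not treated; the constant carries `w` because
the `ℓ^∞` norm is taken over sites AND colours).
[cite: Balaban1983RegularityDecay, Theorem (1.10)–(1.12) p.573; p.579 (between (2.22) and (2.23)); Cor. 2.3 p.581] -/
theorem ineq112_deriv {M : ℝ} (hM : 0 < M) (pos : X → Fin d → ℝ) (c : X → X → ℝ) (m2 a : ℝ)
    (q : Y → X → ℝ) (W : X → X → Matrix κ κ ℝ) (T : Y → X → Matrix κ κ ℝ)
    (hc : ∀ x z', c x z' ≠ 0 → ∀ μ, |pos x μ - pos z' μ| ≤ 1 / 8 * M)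
    (hq : ∀ y x z', q y x ≠ 0 → q y z' ≠ 0 → ∀ μ, |pos x μ - pos z' μ| ≤ 1 / 8 * M)
    (s : Finset (Fin d → ℤ)) (hs : ∀ j x, hCube M j (pos x) ≠ 0 → j ∈ s)
    (S : (Fin d → ℤ) → X → Prop) [∀ j, DecidablePred (S j)]
    (hS : ∀ j z, (∀ μ, |pos z μ - M * j μ| ≤ 7 / 8 * M) → S j z)
    (hS1 : ∀ j z, S j z → ∀ μ, |pos z μ - M * j μ| ≤ M)
    (hSq : ∀ j y z z', q y z ≠ 0 → q y z' ≠ 0 → (S j z ↔ S j z'))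
    (W' : (Fin d → ℤ) → X → X → Matrix κ κ ℝ) (T' : (Fin d → ℤ) → Y → X → Matrix κ κ ℝ)
    (hWW' : ∀ j x z', (∀ μ, |pos x μ - M * j μ| ≤ 3 / 4 * M) → (∀ μ, |pos z' μ - M * j μ| ≤ 3 / 4 * M) →
      W' j x z' = W x z')
    (hTT' : ∀ j y x, q y x ≠ 0 → (∀ μ, |pos x μ - M * j μ| ≤ 3 / 4 * M) → T' j y x = T y x)
    (Ω : X → Prop) [DecidablePred Ω]
    (Gj : (Fin d → ℤ) → Matrix (X × κ) (X × κ) ℝ)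
    (hGj : ∀ j ∈ s, covOp (fun z z' => if (S j z ↔ S j z') then c z z' else 0) m2 a q (W' j) (T' j) * Gj j = 1)
    (GjΩ : (Fin d → ℤ) → Matrix (X × κ) (X × κ) ℝ)
    (hGjΩ : ∀ j ∈ s, covOp (fun z z' => if (S j z ↔ S j z') then (if (Ω z ↔ Ω z') then c z z' else 0) else 0)
      m2 a q (W' j) (T' j) * GjΩ j = 1)
    (G : Matrix (X × κ) (X × κ) ℝ) (hGH : G * covOp (fun z z' => if (Ω z ↔ Ω z') then c z z' else 0) m2 a q W T = 1)
    (G' : Matrix (X × κ) (X × κ) ℝ) (hG'H : G' * covOp c m2 a q W T = 1)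
    -- the bond
    (x y : X) (hxy : ∀ μ, |pos x μ - pos y μ| ≤ 1 / 8 * M) {w : ℝ} (hw0 : 0 ≤ w)
    (hw : ∀ k, ∑ k', |W x y k k'| ≤ w)
    -- the per-cube analytic inputs, for both families of cubes
    {γ γ' β : ℝ} (hγ0 : 0 ≤ γ) (hγ : ∀ i : ↥s, ‖Gj i.1‖ ≤ γ) (hγΩ : ∀ i : ↥s, ‖GjΩ i.1‖ ≤ γ) (hγ'0 : 0 ≤ γ')
    (hγ' : ∀ i : ↥s, ‖(unitOp x y (W x y) - unitOp x x 1) * Gj i.1‖ ≤ γ')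
    (hγ'Ω : ∀ i : ↥s, ‖(unitOp x y (W x y) - unitOp x x 1) * GjΩ i.1‖ ≤ γ') (hβ0 : 0 ≤ β)
    (hβ : ∀ i : ↥s, ‖opK (fun z z' => if (S i.1 z ↔ S i.1 z') then c z z' else 0) m2 a q (W' i.1) (T' i.1)
        (fun z => hCube M i.1 (pos z)) * Gj i.1 * mulH (ι := κ) (fun z => hCube M i.1 (pos z))‖ ≤ β)
    (hβΩ : ∀ i : ↥s, ‖opK (fun z z' => if (S i.1 z ↔ S i.1 z') then (if (Ω z ↔ Ω z') then c z z' else 0) else 0)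
        m2 a q (W' i.1) (T' i.1) (fun z => hCube M i.1 (pos z)) * GjΩ i.1
        * mulH (ι := κ) (fun z => hCube M i.1 (pos z))‖ ≤ β)
    (h3β : (3 : ℝ) ^ d * β ≤ Real.exp (-1))
    -- the support set and the three separations
    (F : X → Prop) [DecidablePred F] {D D₀ D₁ : ℝ}
    (hD : ∀ x', F x' → ∃ μ, D ≤ |pos x μ - pos x' μ|)
    (hD₀ : ∀ x₁, ¬ Ω x₁ → ∃ μ, D₀ ≤ |pos x μ - pos x₁ μ|)
    (hD₁ : ∀ x', F x' → ∀ x₁, ¬ Ω x₁ → ∃ μ, D₁ ≤ |pos x₁ μ - pos x' μ|) :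
    ‖(unitOp x y (W x y) - unitOp x x 1) * (G - G')
        * mulH (ι := κ) (fun z => if F z then (1 : ℝ) else 0)‖
      ≤ 2 ^ (d + 3) * Real.exp (35 / 8) * (γ' + (1 + w) * γ) * Real.exp (-((D + D₀ + D₁) / (2 * M))) := by
  classical
  -- the letters of the two expansions
  set h : (Fin d → ℤ) → X → ℝ := fun j z => hCube M j (pos z) with hh
  set cΩ : X → X → ℝ := fun z z' => if (Ω z ↔ Ω z') then c z z' else 0 with hcΩ
  set cut : (Fin d → ℤ) → X → X → ℝ := fun j z z' => if (S j z ↔ S j z') then c z z' else 0 with hcut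
  set cutΩ : (Fin d → ℤ) → X → X → ℝ := fun j z z' => if (S j z ↔ S j z') then cΩ z z' else 0 with hcutΩ
  set aJ : (Fin d → ℤ) → Matrix (X × κ) (X × κ) ℝ :=
    fun j => mulH (ι := κ) (h j) * Gj j * mulH (ι := κ) (h j) with haJ
  set bJ : (Fin d → ℤ) → Matrix (X × κ) (X × κ) ℝ :=
    fun j => opK (cut j) m2 a q (W' j) (T' j) (h j) * Gj j * mulH (ι := κ) (h j) with hbJ
  set aΩ : (Fin d → ℤ) → Matrix (X × κ) (X × κ) ℝ :=
    fun j => mulH (ι := κ) (h j) * GjΩ j * mulH (ι := κ) (h j) with haΩ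
  set bΩ : (Fin d → ℤ) → Matrix (X × κ) (X × κ) ℝ :=
    fun j => opK (cutΩ j) m2 a q (W' j) (T' j) (h j) * GjΩ j * mulH (ι := κ) (h j) with hbΩ
  set Pb : Matrix (X × κ) (X × κ) ℝ := unitOp x y (W x y) - unitOp x x 1 with hPbdef
  set P' : Matrix (X × κ) (X × κ) ℝ := mulH (ι := κ) (fun z => if F z then (1 : ℝ) else 0) with hP'def
  -- locality of the cut weights
  have hcΩloc : ∀ x z', cΩ x z' ≠ 0 → ∀ μ, |pos x μ - pos z' μ| ≤ 1 / 8 * M :=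
    fun x z' hne μ => cut_local pos c Ω hc x z' hne μ
  have hM8 : 1 / 8 * M ≤ 3 / 4 * M := by nlinarith
  have hcut_loc : ∀ l z z', cut l z z' ≠ 0 → ∀ μ, |pos z μ - pos z' μ| ≤ 3 / 4 * M :=
    fun l z z' hne μ => (cut_local pos c (S l) hc z z' hne μ).trans hM8
  have hcutΩ_loc : ∀ l z z', cutΩ l z z' ≠ 0 → ∀ μ, |pos z μ - pos z' μ| ≤ 3 / 4 * M :=
    fun l z z' hne μ => (cut_local pos cΩ (S l) hcΩloc z z' hne μ).trans hM8
  have hq_loc : ∀ y z z', q y z ≠ 0 → q y z' ≠ 0 → ∀ μ, |pos z μ - pos z' μ| ≤ 3 / 4 * M :=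
    fun y z z' h1 h2 μ => (hq y z z' h1 h2 μ).trans hM8
  -- sizes of the letters
  have hh0 : ∀ j z, 0 ≤ h j z := fun j z => hCube_nonneg M j (pos z)
  have hhle : ∀ j z, h j z ≤ 1 := fun j z => hCube_le_one M j (pos z)
  have hh1 : ∀ j z, |h j z| ≤ 1 := fun j z => abs_le.mpr ⟨by linarith [hh0 j z], hhle j z⟩
  have hnH : ∀ j, ‖mulH (ι := κ) (h j)‖ ≤ 1 := fun j => norm_mulH_le _ zero_le_one (hh1 j)
  have hnP' : ‖P'‖ ≤ 1 := norm_mulH_le _ zero_le_one fun z => by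
    by_cases hz : F z <;> simp [hz]
  have hnUW : ‖unitOp x y (W x y)‖ ≤ w := norm_unitOp_le x y _ hw0 hw
  have hnU1 : ‖unitOp (ι := κ) x x 1‖ ≤ 1 := norm_unitOp_le x x _ zero_le_one fun k => by
    rw [Finset.sum_eq_single k]
    · simp
    · intro k' _ hk'; rw [Matrix.one_apply_ne' hk', abs_zero]
    · intro hk; exact absurd (Finset.mem_univ k) hk
  have hnPb : ‖Pb‖ ≤ w + 1 := (norm_sub_le _ _).trans (add_le_add hnUW hnU1)
  have hnA_gen : ∀ (Gx : Matrix (X × κ) (X × κ) ℝ) (j : Fin d → ℤ), ‖Gx‖ ≤ γ →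
      ‖mulH (ι := κ) (h j) * Gx * mulH (ι := κ) (h j)‖ ≤ γ := by
    intro Gx j hGx
    calc ‖mulH (ι := κ) (h j) * Gx * mulH (ι := κ) (h j)‖
        ≤ ‖mulH (ι := κ) (h j) * Gx‖ * ‖mulH (ι := κ) (h j)‖ := norm_mul_le _ _
      _ ≤ (‖mulH (ι := κ) (h j)‖ * ‖Gx‖) * ‖mulH (ι := κ) (h j)‖ :=
          mul_le_mul_of_nonneg_right (norm_mul_le _ _) (norm_nonneg _)
      _ ≤ (1 * γ) * 1 :=
          mul_le_mul (mul_le_mul (hnH j) hGx (norm_nonneg _) zero_le_one) (hnH j) (norm_nonneg _)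
            (by rw [one_mul]; exact hγ0)
      _ = γ := by ring
  have hnA : ∀ j : ↥s, ‖aJ j.1‖ ≤ γ := fun j => hnA_gen (Gj j.1) j.1 (hγ j)
  have hnAΩ : ∀ j : ↥s, ‖aΩ j.1‖ ≤ γ := fun j => hnA_gen (GjΩ j.1) j.1 (hγΩ j)
  -- `P_b·h_j = h_j(x)P_b + (h_j(y) − h_j(x))E_{xy}[W]` and `‖P_b·h_jG_jh_j‖ ≤ γ' + wγ` for both families
  have hPbH : ∀ j, Pb * mulH (ι := κ) (h j) = h j x • Pb + (h j y - h j x) • unitOp x y (W x y) := by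
    intro j
    simp only [hPbdef, Matrix.sub_mul, unitOp_mul_mulH, smul_sub, sub_smul]
    abel
  have hnPa_gen : ∀ (Gx : Matrix (X × κ) (X × κ) ℝ) (j : Fin d → ℤ), ‖Gx‖ ≤ γ → ‖Pb * Gx‖ ≤ γ' →
      ‖Pb * (mulH (ι := κ) (h j) * Gx * mulH (ι := κ) (h j))‖ ≤ γ' + w * γ := by
    intro Gx j hGx hPGx
    have hsplit : Pb * (mulH (ι := κ) (h j) * Gx * mulH (ι := κ) (h j))
        = h j x • (Pb * Gx * mulH (ι := κ) (h j))
          + (h j y - h j x) • (unitOp x y (W x y) * Gx * mulH (ι := κ) (h j)) := by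
      rw [← Matrix.mul_assoc, ← Matrix.mul_assoc, hPbH j, Matrix.add_mul, Matrix.add_mul, Matrix.smul_mul,
        Matrix.smul_mul, Matrix.smul_mul, Matrix.smul_mul]
    have hdiff : |h j y - h j x| ≤ 1 := by
      rw [abs_le]; constructor <;> linarith [hh0 j y, hhle j y, hh0 j x, hhle j x]
    rw [hsplit]
    calc ‖h j x • (Pb * Gx * mulH (ι := κ) (h j))
          + (h j y - h j x) • (unitOp x y (W x y) * Gx * mulH (ι := κ) (h j))‖
        ≤ ‖h j x • (Pb * Gx * mulH (ι := κ) (h j))‖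
          + ‖(h j y - h j x) • (unitOp x y (W x y) * Gx * mulH (ι := κ) (h j))‖ := norm_add_le _ _
      _ ≤ 1 * (γ' * 1) + 1 * ((w * γ) * 1) := by
          rw [norm_smul, norm_smul, Real.norm_eq_abs, Real.norm_eq_abs]
          refine add_le_add (mul_le_mul (hh1 j x) ?_ (norm_nonneg _) zero_le_one)
            (mul_le_mul hdiff ?_ (norm_nonneg _) zero_le_one)
          · exact (norm_mul_le _ _).trans (mul_le_mul hPGx (hnH j) (norm_nonneg _) hγ'0)
          · exact (norm_mul_le _ _).trans (mul_le_mul ((norm_mul_le _ _).trans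
              (mul_le_mul hnUW hGx (norm_nonneg _) hw0)) (hnH j) (norm_nonneg _) (mul_nonneg hw0 hγ0))
      _ = γ' + w * γ := by ring
  have hnPa : ∀ j : ↥s, ‖Pb * aJ j.1‖ ≤ γ' + w * γ := fun j => hnPa_gen (Gj j.1) j.1 (hγ j) (hγ' j)
  have hnPaΩ : ∀ j : ↥s, ‖Pb * aΩ j.1‖ ≤ γ' + w * γ := fun j => hnPa_gen (GjΩ j.1) j.1 (hγΩ j) (hγ'Ω j)
  -- `‖R‖, ‖R′‖ ≤ 2^dβ ≤ 1/2`
  have h23 : (2 : ℝ) ^ d * β ≤ (3 : ℝ) ^ d * β :=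
    mul_le_mul_of_nonneg_right (pow_le_pow_left₀ (by norm_num) (by norm_num) d) hβ0
  have h3β' : (3 : ℝ) ^ d * β < 1 := h3β.trans_lt (Real.exp_lt_one_iff.mpr (by norm_num))
  have hRhalf : ‖∑ j ∈ s, bJ j‖ ≤ 1 / 2 :=
    ((norm_R_le hM pos c m2 a q hc hq s S W' T' Gj hβ0 hβ).trans h23).trans (h3β.trans exp_neg_one_le_half)
  have hRΩhalf : ‖∑ j ∈ s, bΩ j‖ ≤ 1 / 2 :=
    ((norm_R_le hM pos cΩ m2 a q hcΩloc hq s S W' T' GjΩ hβ0 hβΩ).trans h23).trans (h3β.trans exp_neg_one_le_half)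
  have hRlt : ‖∑ j ∈ s, bJ j‖ < 1 := hRhalf.trans_lt (by norm_num)
  have hRΩlt : ‖∑ j ∈ s, bΩ j‖ < 1 := hRΩhalf.trans_lt (by norm_num)
  -- (2.9)–(2.12) for both propagators
  have h211 : covOp c m2 a q W T * ∑ j ∈ s, aJ j = 1 - ∑ j ∈ s, bJ j :=
    parametrix_identity_hCube hM pos c m2 a q W T s hs S hS hc hq W' T' hWW' hTT' Gj hGj
  have h211Ω : covOp cΩ m2 a q W T * ∑ j ∈ s, aΩ j = 1 - ∑ j ∈ s, bΩ j :=
    parametrix_identity_hCube hM pos cΩ m2 a q W T s hs S hS hcΩloc hq W' T' hWW' hTT' GjΩ hGjΩ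
  have hGeq : G' * (1 - ∑ j ∈ s, bJ j) = ∑ j ∈ s, aJ j := G_mul_one_sub_eq hG'H h211
  have hGeqΩ : G * (1 - ∑ j ∈ s, bΩ j) = ∑ j ∈ s, aΩ j := G_mul_one_sub_eq hGH h211Ω
  have hsum : HasSum (fun n : ℕ => (∑ j ∈ s, aJ j) * (∑ j ∈ s, bJ j) ^ n) G' := hasSum_neumann hRlt hGeq
  have hsumΩ : HasSum (fun n : ℕ => (∑ j ∈ s, aΩ j) * (∑ j ∈ s, bΩ j) ^ n) G := hasSum_neumann hRΩlt hGeqΩ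
  -- `‖G₀‖, ‖G₀^Ω‖ ≤ 2^dγ` and `‖G‖, ‖G′‖ ≤ 2^{d+1}γ`
  have hG0_gen : ∀ (Gx : (Fin d → ℤ) → Matrix (X × κ) (X × κ) ℝ), (∀ j : ↥s, ‖Gx j.1‖ ≤ γ) →
      ‖∑ j ∈ s, mulH (ι := κ) (h j) * Gx j * mulH (ι := κ) (h j)‖ ≤ (2 : ℝ) ^ d * γ := by
    intro Gx hGx
    have hmain := norm_sum_le_of_rowMult s (fun j => mulH (ι := κ) (h j) * Gx j * mulH (ι := κ) (h j)) hγ0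
      (fun l hl => hnA_gen (Gx l) l (hGx ⟨l, hl⟩))
      (fun i : X × κ => Fintype.piFinset fun μ => ({⌊pos i.1 μ / M⌋, ⌊pos i.1 μ / M⌋ + 1} : Finset ℤ))
      (m₀ := 2 ^ d) (fun i => card_labelBox_le M (pos i.1))
      (by
        rintro ⟨z, k⟩ l _ hln p
        have hlz : h l z = 0 := by
          by_contra hne
          exact hln (mem_box_of_hCube_ne_zero hne)
        rw [Matrix.mul_assoc, mulH_mul_apply, hlz, zero_mul])
    exact_mod_cast hmain
  have hG_gen : ∀ {Gbig G0 Rx : Matrix (X × κ) (X × κ) ℝ}, ‖Rx‖ ≤ 1 / 2 → Gbig * (1 - Rx) = G0 →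
      ‖G0‖ ≤ (2 : ℝ) ^ d * γ → ‖Gbig‖ ≤ (2 : ℝ) ^ (d + 1) * γ := by
    intro Gbig G0 Rx hRx hGx hG0x
    have h1 := norm_le_of_neumann (hRx.trans_lt (by norm_num)) hGx
    have hinv : (1 - ‖Rx‖)⁻¹ ≤ 2 := (inv_le_comm₀ (by linarith) two_pos).mpr (by linarith)
    calc ‖Gbig‖ ≤ ‖G0‖ * (1 - ‖Rx‖)⁻¹ := h1
      _ ≤ ((2 : ℝ) ^ d * γ) * 2 := mul_le_mul hG0x hinv (inv_nonneg.mpr (by linarith)) (by positivity)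
      _ = (2 : ℝ) ^ (d + 1) * γ := by ring
  have hG' : ‖G'‖ ≤ (2 : ℝ) ^ (d + 1) * γ := hG_gen hRhalf hGeq (hG0_gen Gj hγ)
  have hG : ‖G‖ ≤ (2 : ℝ) ^ (d + 1) * γ := hG_gen hRΩhalf hGeqΩ (hG0_gen GjΩ hγΩ)
  -- the exponent bookkeeping
  have hexp : Real.exp (-1) * (2 * Real.exp 2 * Real.exp (-((D + D₀ + D₁) / (2 * M) - 27 / 8)))
      = 2 * Real.exp (35 / 8) * Real.exp (-((D + D₀ + D₁) / (2 * M))) := by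
    rw [show (35 / 8 : ℝ) = -1 + 2 + 27 / 8 by norm_num, Real.exp_add, Real.exp_add,
      show -((D + D₀ + D₁) / (2 * M) - 27 / 8) = 27 / 8 + -((D + D₀ + D₁) / (2 * M)) by ring, Real.exp_add]
    ring
  have hKpos : 0 ≤ γ' + (1 + w) * γ := by positivity
  have hα0 : 0 ≤ γ' + w * γ := by positivity
  by_cases hfar : 1 ≤ ⌊(D + D₀ + D₁) / (2 * M) - 27 / 8⌋₊
  · -- FAR: the cancellation of the two walk expansions
    set N : ℕ := ⌊(D + D₀ + D₁) / (2 * M) - 27 / 8⌋₊ with hNdef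
    have hSig : 1 ≤ (D + D₀ + D₁) / (2 * M) - 27 / 8 := by
      by_contra hlt
      rw [not_le] at hlt
      have : N = 0 := Nat.floor_eq_zero.mpr hlt
      omega
    have hNle : (N : ℝ) ≤ (D + D₀ + D₁) / (2 * M) - 27 / 8 := Nat.floor_le (by linarith)
    have hNlt : (D + D₀ + D₁) / (2 * M) - 27 / 8 < N + 1 := Nat.lt_floor_add_one _
    have hNM : ((N : ℝ) + 27 / 8) * M ≤ (D + D₀ + D₁) / 2 := by
      have : (N : ℝ) + 27 / 8 ≤ (D + D₀ + D₁) / 2 / M := by rw [div_div]; linarith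
      rwa [le_div_iff₀ hM] at this
    -- interior cubes and the cubes meeting `Ω^c`
    set TΩ : Finset ↥s := Finset.univ.filter fun j : ↥s => ∃ z, S j.1 z ∧ ¬ Ω z with hTΩ
    have hagree : ∀ j : ↥s, j ∉ TΩ → aΩ j.1 = aJ j.1 ∧ bΩ j.1 = bJ j.1 := by
      intro j hj
      have hSΩ : ∀ z, S j.1 z → Ω z := by
        intro z hz
        by_contra hΩz
        exact hj (Finset.mem_filter.mpr ⟨Finset.mem_univ _, z, hz, hΩz⟩)
      have hsupp : ∀ z, h j.1 z ≠ 0 → S j.1 z := fun z hz =>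
        hS j.1 z fun μ => (hCube_ne_zero_imp hM hz μ).le.trans (by nlinarith)
      have hag := interior_letters_agree c m2 a q (W' j.1) (T' j.1) (S j.1) Ω hSΩ (hSq j.1) (h j.1) hsupp
        (hGj j.1 j.2) (hGjΩ j.1 j.2)
      exact ⟨hag.1.symm, hag.2.symm⟩
    -- the starting cubes (those seeing `x` or `y`) and the final cubes
    set S₀ : Finset ↥s := Finset.univ.filter fun i : ↥s => h i.1 x ≠ 0 ∨ h i.1 y ≠ 0 with hS₀
    set S₁ : Finset ↥s := Finset.univ.filter fun i : ↥s => ∃ x', F x' ∧ h i.1 x' ≠ 0 with hS₁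
    have hP_gen : ∀ (Gx : Matrix (X × κ) (X × κ) ℝ) (i : ↥s), i ∉ S₀ →
        Pb * (mulH (ι := κ) (h i.1) * Gx * mulH (ι := κ) (h i.1)) = 0 := by
      intro Gx i hi
      have hix : h i.1 x = 0 := by
        by_contra hne
        exact hi (Finset.mem_filter.mpr ⟨Finset.mem_univ _, Or.inl hne⟩)
      have hiy : h i.1 y = 0 := by
        by_contra hne
        exact hi (Finset.mem_filter.mpr ⟨Finset.mem_univ _, Or.inr hne⟩)
      have hzero : Pb * mulH (ι := κ) (h i.1) = 0 := by
        rw [hPbH i.1, hix, hiy, sub_zero, zero_smul, zero_smul, add_zero]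
      rw [← Matrix.mul_assoc, ← Matrix.mul_assoc, hzero, Matrix.zero_mul, Matrix.zero_mul]
    have hF0 : ∀ i : ↥s, i ∉ S₁ → mulH (ι := κ) (h i.1) * P' = 0 := by
      intro i hi
      rw [hP'def, mulH_mul_mulH]
      refine mulH_eq_zero_of fun z => ?_
      by_cases hz : F z
      · have hiz : h i.1 z = 0 := by
          by_contra hne
          exact hi (Finset.mem_filter.mpr ⟨Finset.mem_univ _, z, hz, hne⟩)
        rw [hiz, zero_mul]
      · rw [if_neg hz, mul_zero]
    have hP'_gen : ∀ (Kx : Matrix (X × κ) (X × κ) ℝ) (i : ↥s), i ∉ S₁ → Kx * mulH (ι := κ) (h i.1) * P' = 0 := by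
      intro Kx i hi
      rw [Matrix.mul_assoc, hF0 i hi, Matrix.mul_zero]
    have hβ₁_gen : ∀ (B : Matrix (X × κ) (X × κ) ℝ), ‖B‖ ≤ β → ‖B * P'‖ ≤ β := fun B hB =>
      (norm_mul_le _ _).trans (by
        calc ‖B‖ * ‖P'‖ ≤ β * 1 := mul_le_mul hB hnP' (norm_nonneg _) hβ0
          _ = β := mul_one β)
    -- the separation THROUGH a cube meeting `Ω^c`
    have hsep : ∀ i ∈ S₀, ∀ t ∈ TΩ, ∀ l ∈ S₁, ∃ μ ν, (N : ℤ) ≤ |i.1 μ - t.1 μ| + |t.1 ν - l.1 ν| := by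
      intro i hi t ht l hl
      obtain ⟨-, hixy⟩ := Finset.mem_filter.mp hi
      obtain ⟨-, x₁, hSx₁, hΩx₁⟩ := Finset.mem_filter.mp ht
      obtain ⟨-, x', hFx', hlx'⟩ := Finset.mem_filter.mp hl
      -- `i` sees `x` or `y`, and `y` is within `M/8` of `x`: `|x − Mi| < (3/4)M`
      have hi3 : ∀ μ, |pos x μ - M * i.1 μ| < 3 / 4 * M := by
        intro μ
        rcases hixy with hix | hiy
        · exact (hCube_ne_zero_imp hM hix μ).trans (by nlinarith)
        · calc |pos x μ - M * i.1 μ| = |(pos x μ - pos y μ) + (pos y μ - M * i.1 μ)| := by ring_nf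
            _ ≤ |pos x μ - pos y μ| + |pos y μ - M * i.1 μ| := abs_add_le _ _
            _ < 1 / 8 * M + 5 / 8 * M := add_lt_add_of_le_of_lt (hxy μ) (hCube_ne_zero_imp hM hiy μ)
            _ = 3 / 4 * M := by ring
      have ht1 : ∀ μ, |pos x₁ μ - M * t.1 μ| ≤ M := hS1 t.1 x₁ hSx₁
      have hl5 : ∀ μ, |pos x' μ - M * l.1 μ| < 5 / 8 * M := hCube_ne_zero_imp hM hlx'
      -- label distances from site distances
      have hit : ∀ μ, |pos x μ - pos x₁ μ| - 7 / 4 * M < M * |((i.1 μ : ℤ) : ℝ) - t.1 μ| := by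
        intro μ
        have htri : |pos x μ - pos x₁ μ| ≤ |pos x μ - M * i.1 μ| + |M * i.1 μ - M * t.1 μ| + |pos x₁ μ - M * t.1 μ| := by
          calc |pos x μ - pos x₁ μ|
              = |(pos x μ - M * i.1 μ) + (M * i.1 μ - M * t.1 μ) + (M * t.1 μ - pos x₁ μ)| := by ring_nf
            _ ≤ |pos x μ - M * i.1 μ| + |M * i.1 μ - M * t.1 μ| + |M * t.1 μ - pos x₁ μ| := abs_add_three _ _ _
            _ = _ := by rw [abs_sub_comm (M * t.1 μ) (pos x₁ μ)]
        rw [← mul_sub, abs_mul, abs_of_pos hM] at htri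
        linarith [hi3 μ, ht1 μ]
      have htl : ∀ ν, |pos x₁ ν - pos x' ν| - 13 / 8 * M < M * |((t.1 ν : ℤ) : ℝ) - l.1 ν| := by
        intro ν
        have htri : |pos x₁ ν - pos x' ν| ≤ |pos x₁ ν - M * t.1 ν| + |M * t.1 ν - M * l.1 ν| + |pos x' ν - M * l.1 ν| := by
          calc |pos x₁ ν - pos x' ν|
              = |(pos x₁ ν - M * t.1 ν) + (M * t.1 ν - M * l.1 ν) + (M * l.1 ν - pos x' ν)| := by ring_nf
            _ ≤ |pos x₁ ν - M * t.1 ν| + |M * t.1 ν - M * l.1 ν| + |M * l.1 ν - pos x' ν| := abs_add_three _ _ _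
            _ = _ := by rw [abs_sub_comm (M * l.1 ν) (pos x' ν)]
        rw [← mul_sub, abs_mul, abs_of_pos hM] at htri
        linarith [ht1 ν, hl5 ν]
      -- the two cases «max(D, D₀ + D₁) ≥ (D + D₀ + D₁)/2»
      have key : ∃ μ ν, (D + D₀ + D₁) / 2 ≤ |pos x μ - pos x₁ μ| + |pos x₁ ν - pos x' ν| := by
        by_cases hcase : D ≤ D₀ + D₁
        · obtain ⟨μ, hμ⟩ := hD₀ x₁ hΩx₁
          obtain ⟨ν, hν⟩ := hD₁ x' hFx' x₁ hΩx₁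
          exact ⟨μ, ν, by linarith⟩
        · obtain ⟨μ, hμ⟩ := hD x' hFx'
          refine ⟨μ, μ, ?_⟩
          have htri : |pos x μ - pos x' μ| ≤ |pos x μ - pos x₁ μ| + |pos x₁ μ - pos x' μ| := by
            calc |pos x μ - pos x' μ| = |(pos x μ - pos x₁ μ) + (pos x₁ μ - pos x' μ)| := by ring_nf
              _ ≤ _ := abs_add_le _ _
          linarith
      obtain ⟨μ, ν, hμν⟩ := key
      refine ⟨μ, ν, ?_⟩
      have hsum' : (N : ℝ) * M < M * |((i.1 μ : ℤ) : ℝ) - t.1 μ| + M * |((t.1 ν : ℤ) : ℝ) - l.1 ν| := by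
        linarith [hit μ, htl ν]
      rw [← mul_add] at hsum'
      have h5 : (N : ℝ) < |((i.1 μ : ℤ) : ℝ) - t.1 μ| + |((t.1 ν : ℤ) : ℝ) - l.1 ν| := by
        by_contra hle
        rw [not_lt] at hle
        have := mul_le_mul_of_nonneg_left hle hM.le
        linarith
      have h6 : ((N : ℤ) : ℝ) < ((|i.1 μ - t.1 μ| + |t.1 ν - l.1 ν| : ℤ) : ℝ) := by push_cast; exact h5
      exact (Int.cast_lt.mp h6).le
    have hcardS₀ : S₀.card ≤ 2 ^ (d + 1) := by
      have hsub : S₀.map (Function.Embedding.subtype (· ∈ s))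
          ⊆ (Fintype.piFinset fun μ => ({⌊pos x μ / M⌋, ⌊pos x μ / M⌋ + 1} : Finset ℤ))
            ∪ (Fintype.piFinset fun μ => ({⌊pos y μ / M⌋, ⌊pos y μ / M⌋ + 1} : Finset ℤ)) := by
        intro j hj
        obtain ⟨i, hi, rfl⟩ := Finset.mem_map.mp hj
        obtain ⟨-, hixy⟩ := Finset.mem_filter.mp hi
        rcases hixy with hix | hiy
        · exact Finset.mem_union_left _ (mem_box_of_hCube_ne_zero hix)
        · exact Finset.mem_union_right _ (mem_box_of_hCube_ne_zero hiy)
      calc S₀.card = (S₀.map (Function.Embedding.subtype (· ∈ s))).card := (Finset.card_map _).symm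
        _ ≤ _ := Finset.card_le_card hsub
        _ ≤ _ := Finset.card_union_le _ _
        _ ≤ 2 ^ d + 2 ^ d := add_le_add (card_labelBox_le M (pos x)) (card_labelBox_le M (pos y))
        _ = 2 ^ (d + 1) := by ring
    -- locality of the letters (non-neighbouring cubes)
    have hloc_gen : ∀ (cx : (Fin d → ℤ) → X → X → ℝ),
        (∀ l z z', cx l z z' ≠ 0 → ∀ μ, |pos z μ - pos z' μ| ≤ 3 / 4 * M) →
        ∀ i l : ↥s, ¬ cubeAdj (fun i : ↥s => i.1) i l →
          mulH (ι := κ) (h i.1) * opK (cx l.1) m2 a q (W' l.1) (T' l.1) (h l.1) = 0 :=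
      fun cx hcx i l hil => mulH_hCube_mul_opK_eq_zero hM pos (cx l.1) m2 a q (W' l.1) (T' l.1) (hcx l.1) hq_loc hil
    have hab_gen : ∀ (cx : (Fin d → ℤ) → X → X → ℝ) (Gx : (Fin d → ℤ) → Matrix (X × κ) (X × κ) ℝ),
        (∀ l z z', cx l z z' ≠ 0 → ∀ μ, |pos z μ - pos z' μ| ≤ 3 / 4 * M) →
        ∀ i l : ↥s, ¬ cubeAdj (fun i : ↥s => i.1) i l →
          (mulH (ι := κ) (h i.1) * Gx i.1 * mulH (ι := κ) (h i.1))
            * (opK (cx l.1) m2 a q (W' l.1) (T' l.1) (h l.1) * Gx l.1 * mulH (ι := κ) (h l.1)) = 0 := by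
      intro cx Gx hcx i l hil
      rw [show mulH (ι := κ) (h i.1) * Gx i.1 * mulH (ι := κ) (h i.1)
            * (opK (cx l.1) m2 a q (W' l.1) (T' l.1) (h l.1) * Gx l.1 * mulH (ι := κ) (h l.1))
          = mulH (ι := κ) (h i.1) * Gx i.1
            * (mulH (ι := κ) (h i.1) * opK (cx l.1) m2 a q (W' l.1) (T' l.1) (h l.1))
            * Gx l.1 * mulH (ι := κ) (h l.1) by simp only [Matrix.mul_assoc],
        hloc_gen cx hcx i l hil, Matrix.mul_zero, Matrix.zero_mul, Matrix.zero_mul]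
    have hbb_gen : ∀ (cx : (Fin d → ℤ) → X → X → ℝ) (Gx : (Fin d → ℤ) → Matrix (X × κ) (X × κ) ℝ),
        (∀ l z z', cx l z z' ≠ 0 → ∀ μ, |pos z μ - pos z' μ| ≤ 3 / 4 * M) →
        ∀ i l : ↥s, ¬ cubeAdj (fun i : ↥s => i.1) i l →
          (opK (cx i.1) m2 a q (W' i.1) (T' i.1) (h i.1) * Gx i.1 * mulH (ι := κ) (h i.1))
            * (opK (cx l.1) m2 a q (W' l.1) (T' l.1) (h l.1) * Gx l.1 * mulH (ι := κ) (h l.1)) = 0 := by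
      intro cx Gx hcx i l hil
      rw [show opK (cx i.1) m2 a q (W' i.1) (T' i.1) (h i.1) * Gx i.1 * mulH (ι := κ) (h i.1)
            * (opK (cx l.1) m2 a q (W' l.1) (T' l.1) (h l.1) * Gx l.1 * mulH (ι := κ) (h l.1))
          = opK (cx i.1) m2 a q (W' i.1) (T' i.1) (h i.1) * Gx i.1
            * (mulH (ι := κ) (h i.1) * opK (cx l.1) m2 a q (W' l.1) (T' l.1) (h l.1))
            * Gx l.1 * mulH (ι := κ) (h l.1) by simp only [Matrix.mul_assoc],
        hloc_gen cx hcx i l hil, Matrix.mul_zero, Matrix.zero_mul, Matrix.zero_mul]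
    have hr : ((N : ℝ) + 1) - 2 ≤ ((N - 1 : ℕ) : ℝ) := by
      rw [Nat.cast_sub hfar, Nat.cast_one]; linarith
    -- the abstract cancellation bound over the finite label type `↥s`, with `P = P_b`
    have hwalk := lattice_walk_delta_bound (R := Matrix (X × κ) (X × κ) ℝ) (fun i : ↥s => i.1) Subtype.val_injective
      (a := fun i : ↥s => aΩ i.1) (b := fun i : ↥s => bΩ i.1) (a' := fun i : ↥s => aJ i.1) (b' := fun i : ↥s => bJ i.1)
      (P := Pb) (P' := P') (S₀ := S₀) (S₁ := S₁) (T := TΩ) (α := γ' + w * γ) (β := β) (β₁ := β) (N := N)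
      (by rw [Finset.sum_coe_sort s aΩ]) (by rw [Finset.sum_coe_sort s bΩ])
      (by rw [Finset.sum_coe_sort s aJ]) (by rw [Finset.sum_coe_sort s bJ]) hsumΩ hsum
      (hab_gen cutΩ GjΩ hcutΩ_loc) (hbb_gen cutΩ GjΩ hcutΩ_loc) (hab_gen cut Gj hcut_loc) (hbb_gen cut Gj hcut_loc)
      (fun i hi => (hagree i hi).1) (fun i hi => (hagree i hi).2)
      (fun i hi => hP_gen (GjΩ i.1) i hi) (fun i hi => hP_gen (Gj i.1) i hi)
      (fun i hi => hP'_gen _ i hi) (fun i hi => hP'_gen _ i hi) (fun i hi => hP'_gen _ i hi) (fun i hi => hP'_gen _ i hi)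
      hnPaΩ hnPa hβ0 hβΩ hβ (fun i => hβ₁_gen _ (hβΩ i)) (fun i => hβ₁_gen _ (hβ i)) h3β' hfar hsep
    rw [mul_div_assoc] at hwalk
    have htail := tail_222 (by positivity : 0 ≤ (3 : ℝ) ^ d * β) h3β hr
    have hEN : Real.exp (-((N : ℝ) + 1)) ≤ Real.exp (-((D + D₀ + D₁) / (2 * M) - 27 / 8)) :=
      Real.exp_le_exp.mpr (by linarith)
    -- sizes of the factors of the walk bound
    have hC1 : (S₀.card : ℝ) * (γ' + w * γ) * β * (3 : ℝ) ^ d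
        ≤ (2 : ℝ) ^ (d + 1) * (γ' + (1 + w) * γ) * β * (3 : ℝ) ^ d := by
      have h1 : (S₀.card : ℝ) ≤ (2 : ℝ) ^ (d + 1) := by exact_mod_cast hcardS₀
      have h2 : γ' + w * γ ≤ γ' + (1 + w) * γ := by nlinarith
      exact mul_le_mul_of_nonneg_right (mul_le_mul_of_nonneg_right
        (mul_le_mul h1 h2 hα0 (by positivity)) hβ0) (by positivity)
    have hC2 : ((3 : ℝ) ^ d * β) ^ (N - 1) / (1 - (3 : ℝ) ^ d * β)
        ≤ 2 * Real.exp 2 * Real.exp (-((D + D₀ + D₁) / (2 * M) - 27 / 8)) :=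
      htail.trans (mul_le_mul_of_nonneg_left hEN (by positivity))
    have hC0 : 0 ≤ ((3 : ℝ) ^ d * β) ^ (N - 1) / (1 - (3 : ℝ) ^ d * β) :=
      div_nonneg (pow_nonneg (by positivity) _) (by linarith)
    have hC3 : ((3 : ℝ) ^ d * β) * (2 * Real.exp 2 * Real.exp (-((D + D₀ + D₁) / (2 * M) - 27 / 8)))
        ≤ Real.exp (-1) * (2 * Real.exp 2 * Real.exp (-((D + D₀ + D₁) / (2 * M) - 27 / 8))) :=
      mul_le_mul_of_nonneg_right h3β (by positivity)
    calc ‖Pb * (G - G') * P'‖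
        ≤ 2 * (S₀.card * (γ' + w * γ) * β * (3 : ℝ) ^ d
            * (((3 : ℝ) ^ d * β) ^ (N - 1) / (1 - (3 : ℝ) ^ d * β))) := hwalk
      _ ≤ 2 * ((2 : ℝ) ^ (d + 1) * (γ' + (1 + w) * γ) * β * (3 : ℝ) ^ d
            * (2 * Real.exp 2 * Real.exp (-((D + D₀ + D₁) / (2 * M) - 27 / 8)))) :=
          mul_le_mul_of_nonneg_left (mul_le_mul hC1 hC2 hC0 (by positivity)) two_pos.le
      _ = (2 : ℝ) ^ (d + 2) * (γ' + (1 + w) * γ)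
          * (((3 : ℝ) ^ d * β) * (2 * Real.exp 2 * Real.exp (-((D + D₀ + D₁) / (2 * M) - 27 / 8)))) := by ring
      _ ≤ (2 : ℝ) ^ (d + 2) * (γ' + (1 + w) * γ)
          * (Real.exp (-1) * (2 * Real.exp 2 * Real.exp (-((D + D₀ + D₁) / (2 * M) - 27 / 8)))) :=
          mul_le_mul_of_nonneg_left hC3 (by positivity)
      _ = 2 ^ (d + 3) * Real.exp (35 / 8) * (γ' + (1 + w) * γ) * Real.exp (-((D + D₀ + D₁) / (2 * M))) := by
          rw [hexp]; ring
  · -- NEAR (`(D + D₀ + D₁)/(2M) < 35/8`): the sizes of the two Neumann series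
    rw [not_le, Nat.lt_one_iff, Nat.floor_eq_zero] at hfar
    have hE : 1 ≤ Real.exp (35 / 8) * Real.exp (-((D + D₀ + D₁) / (2 * M))) := by
      rw [← Real.exp_add]
      exact Real.one_le_exp_iff.mpr (by linarith)
    calc ‖Pb * (G - G') * P'‖ ≤ ‖Pb * (G - G')‖ * ‖P'‖ := norm_mul_le _ _
      _ ≤ (‖Pb‖ * ‖G - G'‖) * ‖P'‖ := mul_le_mul_of_nonneg_right (norm_mul_le _ _) (norm_nonneg _)
      _ ≤ ((w + 1) * ((2 : ℝ) ^ (d + 1) * γ + (2 : ℝ) ^ (d + 1) * γ)) * 1 :=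
          mul_le_mul (mul_le_mul hnPb ((norm_sub_le _ _).trans (add_le_add hG hG')) (norm_nonneg _)
            (by positivity)) hnP' (norm_nonneg _) (by positivity)
      _ ≤ (2 : ℝ) ^ (d + 3) * (γ' + (1 + w) * γ) * 1 := by
          have hA : 0 ≤ (2 : ℝ) ^ (d + 2) := by positivity
          have h1 : 0 ≤ (2 : ℝ) ^ (d + 2) * γ' := mul_nonneg hA hγ'0
          have h3 : (w + 1) * ((2 : ℝ) ^ (d + 1) * γ + (2 : ℝ) ^ (d + 1) * γ)
              = (2 : ℝ) ^ (d + 2) * ((1 + w) * γ) := by ring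
          have h4 : (2 : ℝ) ^ (d + 3) * (γ' + (1 + w) * γ)
              = 2 * ((2 : ℝ) ^ (d + 2) * γ') + 2 * ((2 : ℝ) ^ (d + 2) * ((1 + w) * γ)) := by ring
          have h2 : 0 ≤ (2 : ℝ) ^ (d + 2) * ((1 + w) * γ) := mul_nonneg hA (mul_nonneg (by linarith) hγ0)
          rw [mul_one, mul_one, h3, h4]
          linarith
      _ ≤ (2 : ℝ) ^ (d + 3) * (γ' + (1 + w) * γ)
          * (Real.exp (35 / 8) * Real.exp (-((D + D₀ + D₁) / (2 * M)))) :=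
          mul_le_mul_of_nonneg_left hE (by positivity)
      _ = 2 ^ (d + 3) * Real.exp (35 / 8) * (γ' + (1 + w) * γ) * Real.exp (-((D + D₀ + D₁) / (2 * M))) := by
          ring

/-- **(1.11)–(1.12) AS PRINTED, derivative member**: for `f` supported in `F` with `sup|f| ≤ φ`, every colour component
of the covariant bond difference of `δG_k(Ω,Ω₀,A)f` over `b = ⟨x,y⟩` obeys
`|(W(x,y)(δG_kf)(y) − (δG_kf)(x))_k| ≤ 2^{d+3}e^{35/8}(γ' + (1 + w)γ)·exp(−(2M)⁻¹(D + D₀ + D₁))·φ` — the `mulVec` form of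
`ineq112_deriv`. [cite: Balaban1983RegularityDecay, Theorem (1.10)–(1.12) p.573; p.579] -/
theorem ineq112_deriv_apply {M : ℝ} (hM : 0 < M) (pos : X → Fin d → ℝ) (c : X → X → ℝ) (m2 a : ℝ)
    (q : Y → X → ℝ) (W : X → X → Matrix κ κ ℝ) (T : Y → X → Matrix κ κ ℝ)
    (hc : ∀ x z', c x z' ≠ 0 → ∀ μ, |pos x μ - pos z' μ| ≤ 1 / 8 * M)
    (hq : ∀ y x z', q y x ≠ 0 → q y z' ≠ 0 → ∀ μ, |pos x μ - pos z' μ| ≤ 1 / 8 * M)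
    (s : Finset (Fin d → ℤ)) (hs : ∀ j x, hCube M j (pos x) ≠ 0 → j ∈ s)
    (S : (Fin d → ℤ) → X → Prop) [∀ j, DecidablePred (S j)]
    (hS : ∀ j z, (∀ μ, |pos z μ - M * j μ| ≤ 7 / 8 * M) → S j z)
    (hS1 : ∀ j z, S j z → ∀ μ, |pos z μ - M * j μ| ≤ M)
    (hSq : ∀ j y z z', q y z ≠ 0 → q y z' ≠ 0 → (S j z ↔ S j z'))
    (W' : (Fin d → ℤ) → X → X → Matrix κ κ ℝ) (T' : (Fin d → ℤ) → Y → X → Matrix κ κ ℝ)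
    (hWW' : ∀ j x z', (∀ μ, |pos x μ - M * j μ| ≤ 3 / 4 * M) → (∀ μ, |pos z' μ - M * j μ| ≤ 3 / 4 * M) →
      W' j x z' = W x z')
    (hTT' : ∀ j y x, q y x ≠ 0 → (∀ μ, |pos x μ - M * j μ| ≤ 3 / 4 * M) → T' j y x = T y x)
    (Ω : X → Prop) [DecidablePred Ω]
    (Gj : (Fin d → ℤ) → Matrix (X × κ) (X × κ) ℝ)
    (hGj : ∀ j ∈ s, covOp (fun z z' => if (S j z ↔ S j z') then c z z' else 0) m2 a q (W' j) (T' j) * Gj j = 1)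
    (GjΩ : (Fin d → ℤ) → Matrix (X × κ) (X × κ) ℝ)
    (hGjΩ : ∀ j ∈ s, covOp (fun z z' => if (S j z ↔ S j z') then (if (Ω z ↔ Ω z') then c z z' else 0) else 0)
      m2 a q (W' j) (T' j) * GjΩ j = 1)
    (G : Matrix (X × κ) (X × κ) ℝ) (hGH : G * covOp (fun z z' => if (Ω z ↔ Ω z') then c z z' else 0) m2 a q W T = 1)
    (G' : Matrix (X × κ) (X × κ) ℝ) (hG'H : G' * covOp c m2 a q W T = 1)
    (x y : X) (hxy : ∀ μ, |pos x μ - pos y μ| ≤ 1 / 8 * M) {w : ℝ} (hw0 : 0 ≤ w)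
    (hw : ∀ k, ∑ k', |W x y k k'| ≤ w)
    {γ γ' β : ℝ} (hγ0 : 0 ≤ γ) (hγ : ∀ i : ↥s, ‖Gj i.1‖ ≤ γ) (hγΩ : ∀ i : ↥s, ‖GjΩ i.1‖ ≤ γ) (hγ'0 : 0 ≤ γ')
    (hγ' : ∀ i : ↥s, ‖(unitOp x y (W x y) - unitOp x x 1) * Gj i.1‖ ≤ γ')
    (hγ'Ω : ∀ i : ↥s, ‖(unitOp x y (W x y) - unitOp x x 1) * GjΩ i.1‖ ≤ γ') (hβ0 : 0 ≤ β)
    (hβ : ∀ i : ↥s, ‖opK (fun z z' => if (S i.1 z ↔ S i.1 z') then c z z' else 0) m2 a q (W' i.1) (T' i.1)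
        (fun z => hCube M i.1 (pos z)) * Gj i.1 * mulH (ι := κ) (fun z => hCube M i.1 (pos z))‖ ≤ β)
    (hβΩ : ∀ i : ↥s, ‖opK (fun z z' => if (S i.1 z ↔ S i.1 z') then (if (Ω z ↔ Ω z') then c z z' else 0) else 0)
        m2 a q (W' i.1) (T' i.1) (fun z => hCube M i.1 (pos z)) * GjΩ i.1
        * mulH (ι := κ) (fun z => hCube M i.1 (pos z))‖ ≤ β)
    (h3β : (3 : ℝ) ^ d * β ≤ Real.exp (-1))
    (F : X → Prop) [DecidablePred F] {D D₀ D₁ : ℝ}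
    (hD : ∀ x', F x' → ∃ μ, D ≤ |pos x μ - pos x' μ|)
    (hD₀ : ∀ x₁, ¬ Ω x₁ → ∃ μ, D₀ ≤ |pos x μ - pos x₁ μ|)
    (hD₁ : ∀ x', F x' → ∀ x₁, ¬ Ω x₁ → ∃ μ, D₁ ≤ |pos x₁ μ - pos x' μ|)
    (f : X × κ → ℝ) (hfF : ∀ p, ¬ F p.1 → f p = 0) {φ : ℝ} (hφ : 0 ≤ φ) (hf : ∀ p, |f p| ≤ φ) (k : κ) :
    |(W x y *ᵥ fld ((G - G') *ᵥ f) y - fld ((G - G') *ᵥ f) x) k|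
      ≤ 2 ^ (d + 3) * Real.exp (35 / 8) * (γ' + (1 + w) * γ) * Real.exp (-((D + D₀ + D₁) / (2 * M))) * φ := by
  have hmain := ineq112_deriv hM pos c m2 a q W T hc hq s hs S hS hS1 hSq W' T' hWW' hTT' Ω Gj hGj GjΩ hGjΩ G hGH
    G' hG'H x y hxy hw0 hw hγ0 hγ hγΩ hγ'0 hγ' hγ'Ω hβ0 hβ hβΩ h3β F hD hD₀ hD₁
  have hP'f : mulH (ι := κ) (fun z => if F z then (1 : ℝ) else 0) *ᵥ f = f := by
    ext p
    rw [mulH_mulVec_apply]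
    by_cases hz : F p.1
    · rw [if_pos hz, one_mul]
    · rw [if_neg hz, zero_mul, hfF p hz]
  have hentry : (((unitOp x y (W x y) - unitOp x x 1) * (G - G')
      * mulH (ι := κ) (fun z => if F z then (1 : ℝ) else 0)) *ᵥ f) (x, k)
      = (W x y *ᵥ fld ((G - G') *ᵥ f) y - fld ((G - G') *ᵥ f) x) k := by
    rw [← Matrix.mulVec_mulVec, ← Matrix.mulVec_mulVec, hP'f, ← fld_apply (((unitOp x y (W x y) - unitOp x x 1)
      *ᵥ ((G - G') *ᵥ f))) x k, fld_bondOp_mulVec]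
  rw [← hentry]
  exact (abs_mulVec_le _ f hφ hf (x, k)).trans (mul_le_mul_of_nonneg_right hmain hφ)

end Route

end Literature.MathematicalPhysics.QuantumFieldTheory.Balaban1983to89.B4Ineq112WalkRouteDeriv
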